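import Literature.AnabelianGeometry.SemiGraphs.PSCVertexBijectionEquivariance
import Literature.AnabelianGeometry.SemiGraphs.PSCCompactification
import Literature.AnabelianGeometry.SemiGraphs.PSCCoveringDatumProofs
import Literature.AnabelianGeometry.SemiGraphs.PSCCompactQuotientTransport
import HarnessLib

/-!
# [CombGC] Thm. 1.6 (ii), descent step (row T16-L09b-E4): reading the "graphic modulo `Ker(↠ Π^cpt)`"
# vertex correspondence off the COMPACTIFIED COVERINGS `(G_U)'`, `(H_{U'})'`

Mochizuki, *A combinatorial version of the Grothendieck conjecture*, Tohoku Math. J. **59** (2007) [CombGC],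
proof of Theorem 1.6 (ii), author's ms p. 14 l.18–28 ("by replacing `G`, `H` by their respective
compactifications [cf. Remark 1.1.6], and replacing `α` by the isomorphism induced by `α` between the
respective quotients … it suffices to prove that `α` induces a functorial bijection between the sets of
vertices of `G`, `H`"), render `paper:url-6994f81053dc` p0014. [cite: MochizukiCombGC2007, Thm 1.6(ii) p.14]

PROOF-ONLY bridge (abc-iut cell, layer L3, `plan/L3/SUBDAG-CombGC-Thm16.md` row T16-L09b, holder
abc-iut-w5-d188).  `PSCVertexBijectionEquivariance.lean` (p421678) proves the descent from hypotheses at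
the level of `Π_G`, `Π_H` (a bijection of the vertex sets of `G_U`, `H_{U'}` as double cosets, "`α`-graphic
modulo a normal `K' ≤ Π_H`", separated modulo `K'`).  This file READS those hypotheses off abc-iut-L3-t4's
encodings of `G_U = G.restrict U hU` (`PSCCoveringDatum.lean`, p417678: vertices `Σ v, dcFin U Π_v`, `vrep`,
`restrict_vertGp`) and of `(G_U)' = (G.restrict U hU).compactify` (`PSCCompactification.lean`, p418457):
§1 the pull-back `Z ↦ (Z.comap mk').map U'.subtype` of subgroups of `U' ⧸ K'` to `Π_H` (injective; carries
`U'⧸K'`-conjugation to `U'`-conjugation; images of `U' ⊓ B` go to `(U' ⊓ B) ⊔ K'↑`; `ᾱ`(images) go to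
`α(·) ⊔ K'↑` for `ᾱ` over `α|_U`); §2 `map_subtype_cptKer_normal`: `Ker(Π_{H_{U'}} ↠ Π^cpt)↑` is NORMAL in
`Π_H` (it is the closure of the normal closure of ALL the `U' ⊓ Π_c^δ`); §3
**`graphic_mod_of_vertexGraphic_compactify`** (the vertex clause of `IsGraphicVia` for `ᾱ_U` ⇒ "graphic
modulo `K'↑`") and **`sep_mod_of_verticialOpenInter_compactify`** (Prop. 1.2 (i) for `(H_{U'})'` ⇒
separation modulo `K'↑`); §4 **`graphic_mod_package`** — the level-`U` datum of p421678's
`isGroupTheoreticallyVerticial_of_graphic_mod`; supplying it at every level proves `α` group-theoretically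
verticial.  Pure plumbing over landed vocabulary; no definitions; nothing here takes a side on
[IUTchIII] Cor. 3.12.
-/

noncomputable section

namespace Literature.AnabelianGeometry.SemiGraphs

namespace PSCDatum

open scoped Pointwise
open PSCCovering

universe u

variable {P : Type u} [Group P] [TopologicalSpace P]
variable {P' : Type u} [Group P'] [TopologicalSpace P']

/-! ### 1. Pull-back of subgroups of `U' ⧸ K'` to `Π_H` -/
section Pullback

variable (U' : Subgroup P') (K' : Subgroup U') [K'.Normal]

omit [TopologicalSpace P'] in
/-- The pull-back `Z ↦ (Z.comap mk').map U'.subtype` of subgroups of `U'⧸K'` to `Π_H` is injective.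
[cite: MochizukiCombGC2007, Rmk 1.1.6 p.8] -/
theorem pullback_injective {Z₁ Z₂ : Subgroup (U' ⧸ K')}
    (h : (Z₁.comap (QuotientGroup.mk' K')).map U'.subtype = (Z₂.comap (QuotientGroup.mk' K')).map U'.subtype) :
    Z₁ = Z₂ :=
  Subgroup.comap_injective (QuotientGroup.mk'_surjective K') (Subgroup.map_injective U'.subtype_injective h)

omit [TopologicalSpace P'] in
/-- The pull-back carries conjugation by `ū ∈ U'⧸K'` to conjugation by `u ∈ U'`.
[cite: MochizukiCombGC2007, Rmk 1.1.6 p.8] -/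
theorem pullback_conj (u : U') (Z : Subgroup (U' ⧸ K')) :
    ((ConjAct.toConjAct (QuotientGroup.mk' K' u) • Z).comap (QuotientGroup.mk' K')).map U'.subtype =
      ConjAct.toConjAct (u : P') • (Z.comap (QuotientGroup.mk' K')).map U'.subtype := by
  have hc : (ConjAct.toConjAct (QuotientGroup.mk' K' u) • Z).comap (QuotientGroup.mk' K') =
      ConjAct.toConjAct u • Z.comap (QuotientGroup.mk' K') := by
    ext x
    rw [Subgroup.mem_comap, Subgroup.mem_pointwise_smul_iff_inv_smul_mem,
      Subgroup.mem_pointwise_smul_iff_inv_smul_mem, Subgroup.mem_comap]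
    simp only [ConjAct.smul_def, ← map_inv, ConjAct.ofConjAct_toConjAct, map_mul]
  rw [hc, map_conj_smul, ConjAct.ofConjAct_toConjAct]
  rfl

omit [TopologicalSpace P'] in
/-- The pull-back of the image of `U' ⊓ B` (i.e. of `B.subgroupOf U'`) in `U'⧸K'` is `(U' ⊓ B) ⊔ K'↑`.
[cite: MochizukiCombGC2007, Rmk 1.1.6 p.8] -/
theorem pullback_map_subgroupOf (B : Subgroup P') :
    (((B.subgroupOf U').map (QuotientGroup.mk' K')).comap (QuotientGroup.mk' K')).map U'.subtype =
      (U' ⊓ B) ⊔ K'.map U'.subtype := by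
  rw [Subgroup.comap_map_eq, QuotientGroup.ker_mk', Subgroup.map_sup, Subgroup.subgroupOf_map_subtype,
    inf_comm]

omit [TopologicalSpace P'] in
/-- The pull-back of the image of any `X ≤ U'` is `X↑ ⊔ K'↑`. [cite: MochizukiCombGC2007, Rmk 1.1.6 p.8] -/
theorem pullback_map (X : Subgroup U') : ((X.map (QuotientGroup.mk' K')).comap (QuotientGroup.mk' K')).map
    U'.subtype = X.map U'.subtype ⊔ K'.map U'.subtype := by
  rw [Subgroup.comap_map_eq, QuotientGroup.ker_mk', Subgroup.map_sup]

variable {U'} {K'}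
variable {U : Subgroup P} {K : Subgroup U} [K.Normal]

/-- For `ᾱ : U⧸K ≅ U'⧸K'` lying over `αU : U ≅ U'`, which in turn lies over `α : Π_G ≅ Π_H`: the pull-back of
`ᾱ(image of X)` is `α(X↑) ⊔ K'↑`. [cite: MochizukiCombGC2007, Thm 1.6(ii) p.14] -/
theorem pullback_map_map (α : P ≃ₜ* P') (αU : U ≃ₜ* U') (hαU : ∀ u : U, ((αU u : U') : P') = α u)
    (ᾱ : (U ⧸ K) ≃ₜ* (U' ⧸ K')) (hᾱ : ∀ u : U, ᾱ (QuotientGroup.mk' K u) = QuotientGroup.mk' K' (αU u))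
    (X : Subgroup U) :
    (((X.map (QuotientGroup.mk' K)).map ᾱ.toMulEquiv.toMonoidHom).comap (QuotientGroup.mk' K')).map
        U'.subtype =
      (X.map U.subtype).map α.toMulEquiv.toMonoidHom ⊔ K'.map U'.subtype := by
  rw [map_map_eq_of_over hᾱ, pullback_map, Subgroup.map_map, Subgroup.map_map]
  congr 2; ext u; exact hαU u

end Pullback

/-! ### 2. `Ker(Π_{H_{U'}} ↠ Π^cpt)↑` is normal in `Π_H` -/
section CptKerNormal

variable [IsTopologicalGroup P'] (H : PSCDatum P') (U' : Subgroup P') [U'.FiniteIndex] [U'.Normal]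
  (hU' : IsOpen (U' : Set P'))

/-- Every `Π_H`-conjugate of a level-`U'` cuspidal group `U' ⊓ Π_c^δ` lies in `Ker(Π_{H_{U'}} ↠ Π^cpt)↑`:
indeed `g (U' ⊓ Π_c^δ) g⁻¹ = U' ⊓ Π_c^{g δ}` is a `U'`-conjugate of one of the representative cuspidal groups
of `H_{U'}` (the cusps of `H_{U'}` over `c` exhaust `U' \ Π_H / Π_c`).
[cite: MochizukiCombGC2007, Def 1.1(ii) p.7] -/
theorem inf_conj_cuspGp_le_map_cptKer (c : H.graph.C) (δ : P') :
    U' ⊓ ConjAct.toConjAct δ • H.cuspGp c ≤ (H.restrict U' hU').cptKer.map U'.subtype := by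
  haveI := (H.restrict U' hU').cptKer_normal
  obtain ⟨u, hu, k, hk, hrep⟩ := exists_dcRep_dcIdx_eq U' (H.cuspGp c) δ
  have hcusp : ((H.restrict U' hU').cuspGp ⟨c, dcIdx U' (H.cuspGp c) δ⟩).map U'.subtype =
      ConjAct.toConjAct u • (U' ⊓ ConjAct.toConjAct δ • H.cuspGp c) := by
    rw [restrict_cuspGp, Subgroup.subgroupOf_map_subtype, inf_comm, crep]
    change U' ⊓ ConjAct.toConjAct (dcRep U' (H.cuspGp c) (dcIdx U' (H.cuspGp c) δ)) • H.cuspGp c = _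
    rw [hrep, conjAct_smul_inf_of_normal inferInstance, map_mul, mul_smul, map_mul, mul_smul,
      Subgroup.conjAct_pointwise_smul_eq_self (Subgroup.le_normalizer hk)]
  have hle : (H.restrict U' hU').cuspGp ⟨c, dcIdx U' (H.cuspGp c) δ⟩ ≤ (H.restrict U' hU').cptKer :=
    (H.restrict U' hU').cuspGp_le_cptKer _
  have hle' : ConjAct.toConjAct (⟨u, hu⟩ : U')⁻¹ •
      (H.restrict U' hU').cuspGp ⟨c, dcIdx U' (H.cuspGp c) δ⟩ ≤ (H.restrict U' hU').cptKer := by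
    rw [← (H.restrict U' hU').cptKer_normal.conjAct (ConjAct.toConjAct (⟨u, hu⟩ : U')⁻¹),
      Subgroup.pointwise_smul_le_pointwise_smul_iff]
    exact hle
  have := Subgroup.map_mono (f := U'.subtype) hle'
  rw [map_conj_smul, hcusp, ← mul_smul] at this
  convert this using 2
  rw [ConjAct.ofConjAct_toConjAct, map_inv, Subgroup.coe_subtype, Subgroup.coe_mk, ← map_mul,
    inv_mul_cancel, map_one, one_smul]

/-- **`Ker(Π_{H_{U'}} ↠ Π^cpt)↑` is normal in `Π_H`.**  It is the closure in `Π_H` of the subgroup generated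
by ALL the `U' ⊓ Π_c^δ`, `δ ∈ Π_H` — a `Π_H`-stable family. [cite: MochizukiCombGC2007, Def 1.1(ii) p.7] -/
theorem map_subtype_cptKer_normal : ((H.restrict U' hU').cptKer.map U'.subtype).Normal := by
  haveI := (H.restrict U' hU').cptKer_normal
  have hU'c : IsClosed (U' : Set P') := Subgroup.isClosed_of_isOpen U' hU'
  have hKc : IsClosed (((H.restrict U' hU').cptKer.map U'.subtype : Subgroup P') : Set P') := by
    have h1 : IsClosed (((H.restrict U' hU').cptKer : Subgroup U') : Set U') :=
      Subgroup.isClosed_topologicalClosure _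
    rw [Subgroup.coe_map]
    exact hU'c.isClosedEmbedding_subtypeVal.isClosedMap _ h1
  let T : Set P' := ⋃ c : H.graph.C, ⋃ δ : P', ((U' ⊓ ConjAct.toConjAct δ • H.cuspGp c : Subgroup P') : Set P')
  let M : Subgroup P' := Subgroup.normalClosure T
  have hMn : M.Normal := Subgroup.normalClosure_normal
  have hMK : M ≤ (H.restrict U' hU').cptKer.map U'.subtype := by
    refine (Subgroup.closure_le _).mpr fun x hx => ?_
    obtain ⟨a, ha, hconj⟩ := Group.mem_conjugatesOfSet_iff.mp hx
    obtain ⟨g, rfl⟩ := isConj_iff.mp hconj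
    simp only [T, Set.mem_iUnion, SetLike.mem_coe] at ha
    obtain ⟨c, δ, ha⟩ := ha
    have hx' : g * a * g⁻¹ ∈ U' ⊓ ConjAct.toConjAct (g * δ) • H.cuspGp c := by
      rw [map_mul, mul_smul, ← conjAct_smul_inf_of_normal inferInstance,
        Subgroup.mem_pointwise_smul_iff_inv_smul_mem]
      simpa [ConjAct.smul_def, mul_assoc] using ha
    exact H.inf_conj_cuspGp_le_map_cptKer U' hU' c (g * δ) hx'
  have hKM : (H.restrict U' hU').cptKer.map U'.subtype ≤ M.topologicalClosure := by
    have hgen : Subgroup.normalClosure (⋃ d : (H.restrict U' hU').graph.C,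
        (((H.restrict U' hU').cuspGp d : Subgroup U') : Set U')) ≤ M.comap U'.subtype := by
      haveI : (M.comap U'.subtype).Normal := hMn.comap _
      refine Subgroup.normalClosure_le_normal ?_
      intro u hu
      simp only [Set.mem_iUnion, SetLike.mem_coe] at hu
      obtain ⟨d, hu⟩ := hu
      rw [SetLike.mem_coe, Subgroup.mem_comap]
      refine Subgroup.subset_normalClosure ?_
      simp only [T, Set.mem_iUnion, SetLike.mem_coe]
      refine ⟨d.1, H.crep U' d, ?_⟩
      have : (u : P') ∈ ((H.restrict U' hU').cuspGp d).map U'.subtype := ⟨u, hu, rfl⟩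
      rwa [restrict_cuspGp, Subgroup.subgroupOf_map_subtype, inf_comm] at this
    intro x hx
    obtain ⟨u, hu, rfl⟩ := hx
    have hu' : u ∈ (Subgroup.normalClosure (⋃ d : (H.restrict U' hU').graph.C,
        (((H.restrict U' hU').cuspGp d : Subgroup U') : Set U'))).topologicalClosure := hu
    have hcl : (Subgroup.normalClosure (⋃ d : (H.restrict U' hU').graph.C,
        (((H.restrict U' hU').cuspGp d : Subgroup U') : Set U'))).topologicalClosure ≤
        (M.topologicalClosure).comap U'.subtype := by
      refine Subgroup.topologicalClosure_minimal _ (hgen.trans ?_) ?_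
      · exact Subgroup.comap_mono M.le_topologicalClosure
      · exact (Subgroup.isClosed_topologicalClosure _).preimage continuous_subtype_val
    exact hcl hu'
  have hMK' : M.topologicalClosure ≤ (H.restrict U' hU').cptKer.map U'.subtype :=
    Subgroup.topologicalClosure_minimal _ hMK hKc
  rw [le_antisymm hKM hMK']
  exact Subgroup.is_normal_topologicalClosure M

end CptKerNormal

/-! ### 3. Reading "graphic modulo `Ker(↠ Π^cpt)`" and separation off the compactified coverings -/
section Level

variable [IsTopologicalGroup P] [IsTopologicalGroup P']
variable (G : PSCDatum P) (H : PSCDatum P') (α : P ≃ₜ* P')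
variable (U : Subgroup P) [U.FiniteIndex] [U.Normal] (hU : IsOpen (U : Set P))
variable (U' : Subgroup P') [U'.FiniteIndex] [U'.Normal] (hU' : IsOpen (U' : Set P'))

omit [IsTopologicalGroup P] in
/-- The representative verticial group of the vertex of `G_U` through `x` over `v` is a `U`-conjugate of
`U ⊓ Π_v^x`. [cite: MochizukiCombGC2007, Def 1.1(ii) p.6] -/
theorem exists_inf_vrep_smul_eq (v : G.graph.V) (x : P) :
    ∃ u ∈ U, U ⊓ ConjAct.toConjAct (G.vrep U ⟨v, dcIdx U (G.vertGp v) x⟩) • G.vertGp v =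
      ConjAct.toConjAct u • (U ⊓ ConjAct.toConjAct x • G.vertGp v) := by
  obtain ⟨u, hu, k, hk, hrep⟩ := exists_dcRep_dcIdx_eq U (G.vertGp v) x
  refine ⟨u, hu, ?_⟩
  change U ⊓ ConjAct.toConjAct (dcRep U (G.vertGp v) (dcIdx U (G.vertGp v) x)) • G.vertGp v = _
  rw [hrep, conjAct_smul_inf_of_normal inferInstance, map_mul, mul_smul, map_mul, mul_smul,
    Subgroup.conjAct_pointwise_smul_eq_self (Subgroup.le_normalizer hk)]

variable [CompactSpace U] [CompactSpace U']
variable [(G.restrict U hU).cptKer.Normal] [(H.restrict U' hU').cptKer.Normal]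

omit [U.Normal] in
/-- The verticial groups of the compactified covering `(G_U)'` are the images of those of `G_U`.
[cite: MochizukiCombGC2007, Rmk 1.1.6 p.8] -/
theorem compactify_restrict_vertGp (X : (G.restrictGraph U).V) :
    (G.restrict U hU).compactify.vertGp X =
      ((G.restrict U hU).vertGp X).map (QuotientGroup.mk' (G.restrict U hU).cptKer) := rfl

/-- **Row T16-L09b-E4, the "graphic modulo `Ker(↠ Π^cpt)`" clause READ OFF the compactified coverings.**
Let `ᾱ : Π_{(G_U)'} ≅ Π_{(H_{U'})'}` (the groups `U ⧸ Ker`, `U' ⧸ Ker'` of abc-iut-L3-t4's `compactify` of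
`restrict`) lie over `αU = α|_U : U ≅ U'`, and let `ι` be a bijection of the vertex sets of the two
coverings along which `ᾱ` is VERTEX-GRAPHIC (the vertex clause of `IsGraphicVia`: `ᾱ(Π̄_X)` is a
conjugate of `Π̄_{ι X}`).  Then for vertices `U x Π_v ↦ U' y Π_w` corresponding under `ι` the subgroup
`α(U ⊓ Π_v^x) · Ker'↑` is a `U'`-conjugate of `(U' ⊓ Π_w^y) · Ker'↑` in `Π_H` — hypothesis `he` of
`PSCVertexBijectionEquivariance.equivariant_of_graphic_mod`. [cite: MochizukiCombGC2007, Thm 1.6(ii) p.14] -/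
theorem graphic_mod_of_vertexGraphic_compactify (hUU' : U.map α.toMulEquiv.toMonoidHom = U')
    (αU : U ≃ₜ* U') (hαU : ∀ u : U, ((αU u : U') : P') = α u)
    (ᾱ : (U ⧸ (G.restrict U hU).cptKer) ≃ₜ* (U' ⧸ (H.restrict U' hU').cptKer))
    (hᾱ : ∀ u : U, ᾱ (QuotientGroup.mk' (G.restrict U hU).cptKer u) =
      QuotientGroup.mk' (H.restrict U' hU').cptKer (αU u))
    (ι : (G.restrictGraph U).V ≃ (H.restrictGraph U').V)
    (hι : ∀ X : (G.restrictGraph U).V, ∃ γ : ConjAct (U' ⧸ (H.restrict U' hU').cptKer),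
      ((G.restrict U hU).compactify.vertGp X).map ᾱ.toMulEquiv.toMonoidHom =
        γ • (H.restrict U' hU').compactify.vertGp (ι X))
    {v : G.graph.V} {x : P} {w : H.graph.V} {y : P'}
    (hxy : ι ⟨v, dcIdx U (G.vertGp v) x⟩ = ⟨w, dcIdx U' (H.vertGp w) y⟩) :
    ∃ u' ∈ U', (U ⊓ ConjAct.toConjAct x • G.vertGp v).map α.toMulEquiv.toMonoidHom ⊔
        (H.restrict U' hU').cptKer.map U'.subtype =
      ConjAct.toConjAct u' • ((U' ⊓ ConjAct.toConjAct y • H.vertGp w) ⊔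
        (H.restrict U' hU').cptKer.map U'.subtype) := by
  have hK'n : ((H.restrict U' hU').cptKer.map U'.subtype).Normal := H.map_subtype_cptKer_normal U' hU'
  obtain ⟨γ, hγ⟩ := hι ⟨v, dcIdx U (G.vertGp v) x⟩
  rw [hxy, compactify_restrict_vertGp, compactify_restrict_vertGp] at hγ
  obtain ⟨u₀, hu₀⟩ : ∃ u₀ : U', ConjAct.toConjAct (QuotientGroup.mk' (H.restrict U' hU').cptKer u₀) = γ := by
    obtain ⟨u₀, hu₀⟩ := QuotientGroup.mk'_surjective (H.restrict U' hU').cptKer (ConjAct.ofConjAct γ)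
    exact ⟨u₀, by rw [hu₀, ConjAct.toConjAct_ofConjAct]⟩
  rw [← hu₀] at hγ
  have hpull := congrArg
    (fun Z : Subgroup (U' ⧸ (H.restrict U' hU').cptKer) =>
      (Z.comap (QuotientGroup.mk' (H.restrict U' hU').cptKer)).map U'.subtype) hγ
  rw [pullback_map_map α αU hαU ᾱ hᾱ, pullback_conj, restrict_vertGp_map, restrict_vertGp,
    pullback_map_subgroupOf] at hpull
  obtain ⟨u₁, hu₁, h₁⟩ := G.exists_inf_vrep_smul_eq U v x
  obtain ⟨u₂, hu₂, h₂⟩ := H.exists_inf_vrep_smul_eq U' w y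
  change (U ⊓ ConjAct.toConjAct (G.vrep U ⟨v, dcIdx U (G.vertGp v) x⟩) • G.vertGp v).map
      α.toMulEquiv.toMonoidHom ⊔ _ = ConjAct.toConjAct (u₀ : P') •
      ((U' ⊓ ConjAct.toConjAct (H.vrep U' ⟨w, dcIdx U' (H.vertGp w) y⟩) • H.vertGp w) ⊔ _) at hpull
  rw [h₁, h₂, map_conj_smul, ← conjAct_smul_sup_of_normal hK'n, ← conjAct_smul_sup_of_normal hK'n,
    ← mul_smul] at hpull
  have hαu₁ : α u₁ ∈ U' := by
    rw [← hUU']; exact ⟨u₁, hu₁, rfl⟩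
  refine ⟨(α u₁)⁻¹ * ((u₀ : P') * u₂), U'.mul_mem (U'.inv_mem hαu₁) (U'.mul_mem u₀.2 hu₂), ?_⟩
  have e1 : ConjAct.toConjAct (α.toMulEquiv.toMonoidHom (ConjAct.ofConjAct (ConjAct.toConjAct u₁))) =
      ConjAct.toConjAct (α u₁) := rfl
  rw [e1, ← map_mul] at hpull
  rw [map_mul, map_inv, mul_smul, eq_inv_smul_iff, hpull]

/-- **Row T16-L09b-E4, SEPARATION modulo `Ker(↠ Π^cpt)` READ OFF Prop. 1.2 (i) for `(H_{U'})'`**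
(`VerticialOpenInterDeterminesVertex` of the compactified covering, BY NAME): if the level-`U'` groups
`(U' ⊓ Π_{w₁}^{y₁}) · Ker'↑` and `(U' ⊓ Π_{w₂}^{y₂}) · Ker'↑` are `U'`-conjugate, the vertices `U' y₁ Π_{w₁}`,
`U' y₂ Π_{w₂}` of `H_{U'}` coincide — hypothesis `hsep` of
`PSCVertexBijectionEquivariance.equivariant_of_graphic_mod`. [cite: MochizukiCombGC2007, Prop 1.2(i) p.8] -/
theorem sep_mod_of_verticialOpenInter_compactify
    (hV : ((H.restrict U' hU').compactify).VerticialOpenInterDeterminesVertex)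
    {w₁ : H.graph.V} {y₁ : P'} {w₂ : H.graph.V} {y₂ : P'}
    (h : ∃ u' ∈ U', (U' ⊓ ConjAct.toConjAct y₁ • H.vertGp w₁) ⊔ (H.restrict U' hU').cptKer.map U'.subtype =
      ConjAct.toConjAct u' • ((U' ⊓ ConjAct.toConjAct y₂ • H.vertGp w₂) ⊔
        (H.restrict U' hU').cptKer.map U'.subtype)) :
    (⟨w₁, DoubleCoset.mk U' (H.vertGp w₁) y₁⟩ :
        Σ w, DoubleCoset.Quotient (U' : Set P') (H.vertGp w : Set P')) =
      ⟨w₂, DoubleCoset.mk U' (H.vertGp w₂) y₂⟩ := by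
  have hK'n : ((H.restrict U' hU').cptKer.map U'.subtype).Normal := H.map_subtype_cptKer_normal U' hU'
  obtain ⟨u', hu', h⟩ := h
  obtain ⟨u₁, hu₁, h₁⟩ := H.exists_inf_vrep_smul_eq U' w₁ y₁
  obtain ⟨u₂, hu₂, h₂⟩ := H.exists_inf_vrep_smul_eq U' w₂ y₂
  have hP : ∀ X : (H.restrictGraph U').V,
      ((((H.restrict U' hU').compactify.vertGp X).comap
        (QuotientGroup.mk' (H.restrict U' hU').cptKer)).map U'.subtype) =
        (U' ⊓ ConjAct.toConjAct (H.vrep U' X) • H.vertGp X.1) ⊔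
          (H.restrict U' hU').cptKer.map U'.subtype := by
    intro X
    rw [compactify_restrict_vertGp, restrict_vertGp, pullback_map_subgroupOf]
  have hgU' : u₁ * u' * u₂⁻¹ ∈ U' := U'.mul_mem (U'.mul_mem hu₁ hu') (U'.inv_mem hu₂)
  have hrel : ((((H.restrict U' hU').compactify.vertGp ⟨w₁, dcIdx U' (H.vertGp w₁) y₁⟩).comap
        (QuotientGroup.mk' (H.restrict U' hU').cptKer)).map U'.subtype) =
      (((ConjAct.toConjAct (QuotientGroup.mk' (H.restrict U' hU').cptKer ⟨u₁ * u' * u₂⁻¹, hgU'⟩) •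
        (H.restrict U' hU').compactify.vertGp ⟨w₂, dcIdx U' (H.vertGp w₂) y₂⟩).comap
          (QuotientGroup.mk' (H.restrict U' hU').cptKer)).map U'.subtype) := by
    rw [pullback_conj, hP, hP]
    change (U' ⊓ ConjAct.toConjAct (H.vrep U' ⟨w₁, dcIdx U' (H.vertGp w₁) y₁⟩) • H.vertGp w₁) ⊔ _ =
      ConjAct.toConjAct (u₁ * u' * u₂⁻¹) •
        ((U' ⊓ ConjAct.toConjAct (H.vrep U' ⟨w₂, dcIdx U' (H.vertGp w₂) y₂⟩) • H.vertGp w₂) ⊔ _)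
    rw [h₁, h₂, ← conjAct_smul_sup_of_normal hK'n, h, ← conjAct_smul_sup_of_normal hK'n, ← mul_smul,
      ← mul_smul, ← map_mul, ← map_mul]
    congr 2
    group
  have heq := pullback_injective U' _ hrel
  have hX : (⟨w₁, dcIdx U' (H.vertGp w₁) y₁⟩ : (H.restrictGraph U').V) = ⟨w₂, dcIdx U' (H.vertGp w₂) y₂⟩ := by
    refine hV _ _ 1
      (ConjAct.toConjAct (QuotientGroup.mk' (H.restrict U' hU').cptKer ⟨u₁ * u' * u₂⁻¹, hgU'⟩)) ?_
    exact isOpen_subgroupOf_inf_of_eq (by rw [one_smul, heq])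
  have hw : w₁ = w₂ := congrArg Sigma.fst hX
  subst hw
  have hidx : dcIdx U' (H.vertGp w₁) y₁ = dcIdx U' (H.vertGp w₁) y₂ := eq_of_heq (Sigma.mk.inj_iff.mp hX).2
  have hmk : DoubleCoset.mk U' (H.vertGp w₁) y₁ = DoubleCoset.mk U' (H.vertGp w₁) y₂ :=
    (dcEnum U' (H.vertGp w₁)).injective hidx
  rw [hmk]

/-! ### 4. The level-`U` package for `PSCVertexBijectionEquivariance.isGroupTheoreticallyVerticial_of_graphic_mod` -/

/-- **Row T16-L09b-E4, PACKAGED: one level of the descent.**  From a VERTEX-GRAPHIC isomorphism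
`ᾱ : Π_{(G_U)'} ≅ Π_{(H_{U'})'}` over `α|_U` between the compactified coverings (along a vertex bijection `ι`)
and Prop. 1.2 (i) for `(H_{U'})'` (`VerticialOpenInterDeterminesVertex`, BY NAME), the level-`U` datum
required by `isGroupTheoreticallyVerticial_of_graphic_mod` (p421678): a normal `K' ≤ Π_H` (namely
`Ker(Π_{H_{U'}} ↠ Π^cpt)↑`), a bijection of the vertex sets as double cosets (namely `ι` re-indexed by
`dcEnum`), `α`-graphic modulo `K'` and separated modulo `K'`.  Supplying this at every open normal `U`
(with `U' = α U`) proves that `α` is group-theoretically verticial — the descent of Thm. 1.6 (ii) from the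
compactifications to `α`. [cite: MochizukiCombGC2007, Thm 1.6(ii) p.14] -/
theorem graphic_mod_package (hUU' : U.map α.toMulEquiv.toMonoidHom = U')
    (αU : U ≃ₜ* U') (hαU : ∀ u : U, ((αU u : U') : P') = α u)
    (ᾱ : (U ⧸ (G.restrict U hU).cptKer) ≃ₜ* (U' ⧸ (H.restrict U' hU').cptKer))
    (hᾱ : ∀ u : U, ᾱ (QuotientGroup.mk' (G.restrict U hU).cptKer u) =
      QuotientGroup.mk' (H.restrict U' hU').cptKer (αU u))
    (ι : (G.restrictGraph U).V ≃ (H.restrictGraph U').V)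
    (hι : ∀ X : (G.restrictGraph U).V, ∃ γ : ConjAct (U' ⧸ (H.restrict U' hU').cptKer),
      ((G.restrict U hU).compactify.vertGp X).map ᾱ.toMulEquiv.toMonoidHom =
        γ • (H.restrict U' hU').compactify.vertGp (ι X))
    (hV : ((H.restrict U' hU').compactify).VerticialOpenInterDeterminesVertex) :
    ∃ (K' : Subgroup P') (_ : K'.Normal)
      (e : (Σ v, DoubleCoset.Quotient (U : Set P) (G.vertGp v : Set P)) ≃
        (Σ w, DoubleCoset.Quotient (U' : Set P') (H.vertGp w : Set P'))),
      (∀ (v : G.graph.V) (x : P) (w : H.graph.V) (y : P'),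
        e ⟨v, DoubleCoset.mk U (G.vertGp v) x⟩ = ⟨w, DoubleCoset.mk U' (H.vertGp w) y⟩ →
          ∃ u' ∈ U', (U ⊓ ConjAct.toConjAct x • G.vertGp v).map α.toMulEquiv.toMonoidHom ⊔ K' =
            ConjAct.toConjAct u' • ((U' ⊓ ConjAct.toConjAct y • H.vertGp w) ⊔ K')) ∧
      (∀ (w₁ : H.graph.V) (y₁ : P') (w₂ : H.graph.V) (y₂ : P'),
        (∃ u' ∈ U', (U' ⊓ ConjAct.toConjAct y₁ • H.vertGp w₁) ⊔ K' =
            ConjAct.toConjAct u' • ((U' ⊓ ConjAct.toConjAct y₂ • H.vertGp w₂) ⊔ K')) →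
          (⟨w₁, DoubleCoset.mk U' (H.vertGp w₁) y₁⟩ :
              Σ w, DoubleCoset.Quotient (U' : Set P') (H.vertGp w : Set P')) =
            ⟨w₂, DoubleCoset.mk U' (H.vertGp w₂) y₂⟩) := by
  refine ⟨(H.restrict U' hU').cptKer.map U'.subtype, H.map_subtype_cptKer_normal U' hU',
    (Equiv.sigmaCongrRight fun v => dcEnum U (G.vertGp v)).trans
      (ι.trans (Equiv.sigmaCongrRight fun w => (dcEnum U' (H.vertGp w)).symm)), ?_, ?_⟩
  · intro v x w y hexy
    rcases hιX : ι ⟨v, dcIdx U (G.vertGp v) x⟩ with ⟨w', j⟩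
    have hexy' : (⟨w', (dcEnum U' (H.vertGp w')).symm j⟩ :
        Σ w, DoubleCoset.Quotient (U' : Set P') (H.vertGp w : Set P')) =
        ⟨w, DoubleCoset.mk U' (H.vertGp w) y⟩ := by
      rw [← hexy]
      simp only [Equiv.trans_apply, Equiv.sigmaCongrRight_apply]
      change _ = (⟨(ι ⟨v, dcIdx U (G.vertGp v) x⟩).1,
        (dcEnum U' (H.vertGp (ι ⟨v, dcIdx U (G.vertGp v) x⟩).1)).symm (ι ⟨v, dcIdx U (G.vertGp v) x⟩).2⟩ :
          Σ w, DoubleCoset.Quotient (U' : Set P') (H.vertGp w : Set P'))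
      rw [hιX]
    have hw : w' = w := congrArg Sigma.fst hexy'
    subst hw
    have hj : (dcEnum U' (H.vertGp w')).symm j = DoubleCoset.mk U' (H.vertGp w') y :=
      eq_of_heq (Sigma.mk.inj_iff.mp hexy').2
    have hj' : j = dcIdx U' (H.vertGp w') y := by
      rw [Equiv.symm_apply_eq] at hj
      exact hj
    rw [hj'] at hιX
    exact graphic_mod_of_vertexGraphic_compactify G H α U hU U' hU' hUU' αU hαU ᾱ hᾱ ι hι hιX
  · intro w₁ y₁ w₂ y₂ h
    exact sep_mod_of_verticialOpenInter_compactify H U' hU' hV h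

end Level

end PSCDatum

end Literature.AnabelianGeometry.SemiGraphs
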